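import Mathlib
import Literature.MathematicalPhysics.QuantumLattice.TorusPairSusceptibility
import Literature.MathematicalPhysics.QuantumLattice.HubbardModel
import Literature.MathematicalPhysics.QuantumLattice.DWaveSource
import HarnessLib

/-!
# Crux `WcbcsSsbToTorusLRO` (stmt-HubbardSuperconductivity-2009), line `off-zero-mode-moment-closure`:
# the charging floor (C) from its minimal supplier, a POWER-LAW charging rate

The registered stub (C) `stub_chargingFloor` asks, under the crux hypotheses at `(U, δ, μ)`, that along even
sides `L = 2k+2` the pair excitation gap `pairGap (hubbardTorus 2 L 1 U) N_L = ½[E(N_L+2) + E(N_L−2) − 2E(N_L)]`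
(`E(M) = minEnergyOn _ (szSector M 0)`, `N_L = 2⌊(1−δ)L²/2⌋`) is not negative at the `1/log L` scale:
`∀ ε > 0, ∀ᶠ k, −ε ≤ (1 + log L) · pairGap`. This file records the minimal supplier and the adapter:

* `chargingFloor_of_rate` — POINTWISE in `(U, δ)`: any power-law floor `−c/L^s ≤ pairGap` eventually (some real
  `c`, some `s > 0`) gives the (C)-body, because `(1 + log L)·c/L^s → 0`;
* `stub_chargingFloor_of_rate` — the registered guarded signature of (C) from the guarded rate form
  `∃ U₀ > 0, ∀ U ∈ (0,U₀), ∀ δ ∈ (0,1/2), ∃ c, ∃ s > 0, ∀ᶠ k, −c/L^s ≤ pairGap` (the density-matching and order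
  hypotheses of the stub are not used: (C) is a statement about three canonical sector energies).

Expected truth of the rate form: `pairGap ≥ −c·U/L²` from first-order open-shell bookkeeping (the Hartree part of
`E(N)` is affine in the shell filling, the shell-internal repulsion is `O(U d²/L²)`), `≈ +1/(κL²)` in any
compressible homogeneous phase; false only at canonical phase separation at the filling `N_L`. No rate is
provable today at fixed `U > 0` (thermodynamic convexity has no rate; the one-particle cost gives only `O(1)`).
Elementary real analysis over the tree's definitions; no definition and no named fact is introduced.
-/

noncomputable section

set_option linter.dupNamespace false

namespace Summit.HubbardSuperconductivity.HubbardSuperconductivity.Theorems.WcbcsSsbToTorusLRO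

open Literature.MathematicalPhysics.QuantumLattice Literature.Probability.LatticeModels
open Filter Set
open scoped Topology

/-- `(1 + log x) · c / x^s → 0` as `x → ∞` for `s > 0`. [folklore] -/
theorem tendsto_one_add_log_mul_div_rpow (c : ℝ) {s : ℝ} (hs : 0 < s) :
    Tendsto (fun x : ℝ => (1 + Real.log x) * c / x ^ s) atTop (𝓝 0) := by
  have h1 : Tendsto (fun x : ℝ => Real.log x / x ^ s) atTop (𝓝 0) :=
    (isLittleO_log_rpow_atTop hs).tendsto_div_nhds_zero
  have h2 : Tendsto (fun x : ℝ => (x ^ s)⁻¹) atTop (𝓝 0) :=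
    (tendsto_rpow_atTop hs).inv_tendsto_atTop
  have h3 : Tendsto (fun x : ℝ => c * ((x ^ s)⁻¹ + Real.log x / x ^ s)) atTop (𝓝 (c * (0 + 0))) :=
    (h2.add h1).const_mul c
  rw [add_zero, mul_zero] at h3
  refine h3.congr' ?_
  filter_upwards [eventually_gt_atTop (0:ℝ)] with x hx
  have hxs : x ^ s ≠ 0 := (Real.rpow_pos_of_pos hx s).ne'
  field_simp

/-- The even side `2k+2`, cast to `ℝ`, tends to `+∞` with `k`. [folklore] -/
theorem tendsto_evenSide_atTop :
    Tendsto (fun k : ℕ => ((2 * k + 1 + 1 : ℕ) : ℝ)) atTop atTop := by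
  refine tendsto_natCast_atTop_atTop.comp ?_
  exact tendsto_atTop_atTop.2 fun b => ⟨b, fun k hk => by omega⟩

/-- **The charging floor (C) from a power-law charging rate, pointwise in `(U, δ)`.** If eventually along even
sides `−c/L^s ≤ pairGap (hubbardTorus 2 L 1 U) N_L` for some real `c` and some `s > 0`, then for every `ε > 0`,
eventually `−ε ≤ (1 + log L) · pairGap (hubbardTorus 2 L 1 U) N_L`. [folklore] -/
theorem chargingFloor_of_rate {U δ : ℝ}
    (h : ∃ c s : ℝ, 0 < s ∧ ∀ᶠ k : ℕ in Filter.atTop, -c / ((2 * k + 1 + 1 : ℕ) : ℝ) ^ s ≤ pairGap (hubbardTorus 2 (2 * k + 1 + 1) 1 U) (2 * ⌊(1 - δ) * ((2 * k + 1 + 1 : ℕ) : ℝ) ^ 2 / 2⌋₊)) :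
    ∀ ε : ℝ, 0 < ε → ∀ᶠ k : ℕ in Filter.atTop, -ε ≤ (1 + Real.log ((2 * k + 1 + 1 : ℕ) : ℝ)) * pairGap (hubbardTorus 2 (2 * k + 1 + 1) 1 U) (2 * ⌊(1 - δ) * ((2 * k + 1 + 1 : ℕ) : ℝ) ^ 2 / 2⌋₊) := by
  obtain ⟨c, s, hs, hev⟩ := h
  intro ε hε
  -- replace `c` by `c' = max c 0 ≥ 0`
  set c' : ℝ := max c 0 with hc'_def
  have hc' : 0 ≤ c' := le_max_right _ _
  have hcc' : c ≤ c' := le_max_left _ _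
  have ht : Tendsto (fun k : ℕ => (1 + Real.log ((2 * k + 1 + 1 : ℕ) : ℝ)) * c' / ((2 * k + 1 + 1 : ℕ) : ℝ) ^ s)
      atTop (𝓝 0) :=
    (tendsto_one_add_log_mul_div_rpow c' hs).comp tendsto_evenSide_atTop
  have hsmall : ∀ᶠ k : ℕ in atTop,
      (1 + Real.log ((2 * k + 1 + 1 : ℕ) : ℝ)) * c' / ((2 * k + 1 + 1 : ℕ) : ℝ) ^ s < ε :=
    ht.eventually (gt_mem_nhds hε)
  filter_upwards [hev, hsmall] with k hk hks
  have hLpos : (0 : ℝ) < ((2 * k + 1 + 1 : ℕ) : ℝ) := by positivity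
  have hL1 : (1 : ℝ) ≤ ((2 * k + 1 + 1 : ℕ) : ℝ) := by exact_mod_cast (by omega : 1 ≤ 2 * k + 1 + 1)
  have hlog : 0 ≤ 1 + Real.log ((2 * k + 1 + 1 : ℕ) : ℝ) := by
    have := Real.log_nonneg hL1
    linarith
  have hLs : 0 < ((2 * k + 1 + 1 : ℕ) : ℝ) ^ s := Real.rpow_pos_of_pos hLpos s
  -- `-c'/L^s ≤ -c/L^s ≤ pairGap`
  have hk' : -c' / ((2 * k + 1 + 1 : ℕ) : ℝ) ^ s ≤
      pairGap (hubbardTorus 2 (2 * k + 1 + 1) 1 U) (2 * ⌊(1 - δ) * ((2 * k + 1 + 1 : ℕ) : ℝ) ^ 2 / 2⌋₊) := by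
    refine le_trans ?_ hk
    exact div_le_div_of_nonneg_right (neg_le_neg hcc') hLs.le
  have hmul := mul_le_mul_of_nonneg_left hk' hlog
  have e1 : (1 + Real.log ((2 * k + 1 + 1 : ℕ) : ℝ)) * (-c' / ((2 * k + 1 + 1 : ℕ) : ℝ) ^ s) =
      -((1 + Real.log ((2 * k + 1 + 1 : ℕ) : ℝ)) * c' / ((2 * k + 1 + 1 : ℕ) : ℝ) ^ s) := by ring
  rw [e1] at hmul
  linarith

/-- **The registered stub (C) `stub_chargingFloor` from the guarded power-law rate form** (its minimal supplier,
`ChargingFloorRate`: `∃ U₀ > 0, ∀ U ∈ (0,U₀), ∀ δ ∈ (0,1/2), ∃ c, ∃ s > 0, ∀ᶠ k, −c/L^s ≤ pairGap (hubbardTorus 2 L 1 U) N_L`).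
The density-matching and order hypotheses of the stub are idle: (C) is a statement about three canonical sector
energies of the source-free torus. [folklore] -/
theorem stub_chargingFloor_of_rate :
    (∃ U₀ : ℝ, 0 < U₀ ∧ ∀ U ∈ Set.Ioo (0:ℝ) U₀, ∀ δ ∈ Set.Ioo (0:ℝ) (1 / 2), ∃ c s : ℝ, 0 < s ∧ ∀ᶠ k : ℕ in Filter.atTop, -c / ((2 * k + 1 + 1 : ℕ) : ℝ) ^ s ≤ pairGap (hubbardTorus 2 (2 * k + 1 + 1) 1 U) (2 * ⌊(1 - δ) * ((2 * k + 1 + 1 : ℕ) : ℝ) ^ 2 / 2⌋₊)) → ∃ U₀ : ℝ, 0 < U₀ ∧ ∀ U ∈ Set.Ioo (0:ℝ) U₀, ∀ δ ∈ Set.Ioo (0:ℝ) (1 / 2), ∀ μ : ℝ, Filter.Tendsto (fun L : ℕ => ((hubbardTorusWith 2 (L + 1) 1 U μ).groundStateFunctional totalNumber).re / ((L + 1 : ℕ) : ℝ) ^ 2) Filter.atTop (nhds (1 - δ)) → HasDWaveOrder U μ → ∀ ε : ℝ, 0 < ε → ∀ᶠ k : ℕ in Filter.atTop, -ε ≤ (1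 + Real.log ((2 * k + 1 + 1 : ℕ) : ℝ)) * pairGap (hubbardTorus 2 (2 * k + 1 + 1) 1 U) (2 * ⌊(1 - δ) * ((2 * k + 1 + 1 : ℕ) : ℝ) ^ 2 / 2⌋₊) := by
  intro h
  obtain ⟨U₀, hU₀, h⟩ := h
  refine ⟨U₀, hU₀, fun U hU δ hδ μ _ _ => ?_⟩
  exact chargingFloor_of_rate (h U hU δ hδ)

end Summit.HubbardSuperconductivity.HubbardSuperconductivity.Theorems.WcbcsSsbToTorusLRO

end
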